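import Summits.Parity.GeneralizedHardyLittlewood.Theses.GreenTaoLevelTwo
import Literature.NumberTheory.Sieve.LinearEquationsInPrimesLevelTwoSharp
import HarnessLib

/-!
# Route `GreenTaoLevelTwo` — support item `SharpTwo` (stmt-Parity-21277)

The by-name closing file: the route item `SharpTwo` is by definition the Literature statement
`Literature.NumberTheory.Sieve.GreenTaoLevelTwo.SharpTwo` (the sharp estimate (12.6) of Green–Tao 2010 at
level `s = 2`), PROVED in the tree as `Literature.NumberTheory.Sieve.GreenTaoLevelTwo.SharpTwo_holds`
(file `Literature/NumberTheory/Sieve/LinearEquationsInPrimesLevelTwoSharp.lean`, the `s = 2` instance of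
`GreenTao2010_sharpGoldstonYildirim_holds`).  Honesty label (ROUND-6 §0): formalisation-first of a printed
theorem; FRONTIER rung F-GT2; no summit motion.
-/

namespace Summit.Parity.GeneralizedHardyLittlewood.Theorems

/-- **`SharpTwo` holds** (route `GreenTaoLevelTwo`, support stmt-Parity-21277): the sharp Goldston–Yıldırım
estimate (12.6) at level 2, `‖Λ♯_{χ,N^γ,b,W} − 1‖_{U³[N]} = o(1)` uniformly in `b` coprime to `W`, for an
admissible cutoff `χ` and some `γ > 0`.  Proof: the Literature theorem `GreenTaoLevelTwo.SharpTwo_holds`. -/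
theorem greenTaoLevelTwo_sharpTwo_proof :
    Summit.Parity.GeneralizedHardyLittlewood.Theses.GreenTaoLevelTwo.SharpTwo := by
  unfold Summit.Parity.GeneralizedHardyLittlewood.Theses.GreenTaoLevelTwo.SharpTwo
  exact Literature.NumberTheory.Sieve.GreenTaoLevelTwo.SharpTwo_holds

end Summit.Parity.GeneralizedHardyLittlewood.Theorems
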